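import Literature.Probability.Percolation.TriCrossingSandwichMarked
import Literature.Probability.Percolation.TriApproxDomainProofs
import Literature.Probability.Percolation.ChayesLeiHexProofs
import Literature.Probability.Percolation.CardyFormula
import Literature.Probability.Percolation.PlanarDuality
import Literature.Probability.RandomPlanarGeometry.MarkedDomainCorners

/-!
# Route CardyBondTriangular · crux `BondTriangularCardy` (stmt-CriticalPhenomena-4664), line `birth`,
# stub `stub_discreteDomains`, part (D2), lower inclusion, I: the bond lattice at mesh `δ/√3`,
# frontier points near far hexagons, and the run extraction along an open bond path

Helper of the stub `stub_discreteDomains` (`Sig.discreteDomains`, sandwich clause, lower half),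
first file (the deterministic geometric lemmas; the assembly `crude_or_cornerArm_of_yellowCrossing`
is the sibling file `…CrudeLower.lean`).
Bollobás–Riordan, *Percolation* (CUP 2006), Ch. 7, Claim 19 (first part) and Claim 20, p. 192,
with the remark p. 195, for CRITICAL BOND PERCOLATION ON `𝕋` in its Chayes–Lei hexagon
representation (`clOfBond`, Chayes–Lei 2007 §2.1) and the crude crossing event
`embDomainCrossing` of the route (embedding `z x = √3 (triEmbed x - (1+ζ)/3)`, mesh `δ/√3`):

Let `G` be a 4-marked discrete domain placed in `δ𝕋` which is longer–thinner than the conformal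
rectangle `R` at precision `t` and corner radius `ρ` (`TriMarkedDomain.IsLongerThinner`), and let
`Q` be a `𝕋`-walk of hexagons of `G`, none pure blue, consecutive ones sharing a yellow (half-)edge
in the packaged configuration `clOfBond ω`, from a hexagon of the discrete arc `A₂(G)` to a hexagon
of `A₀(G)`. Then (`crude_or_cornerArm_of_yellowCrossing`), for `δ < δ₀(R, ρ)`, `t ≤ t₀(R, ρ)`:
EITHER `ω` has a crude open crossing of `Ω` at mesh `δ/√3` — an open bond path all of whose
vertices `y` have `δ (triEmbed y - (1+ζ)/3) ∈ Ω`, from a vertex within `2δ/√3` of `A₀` to a vertex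
within `2δ/√3` of `A₂` — OR some hexagon of `Q` within `ρ` of a marked point of `R` is joined by a
yellow path to a hexagon farther than `r₂ = r₂(R)` from it (a yellow corner arm).

Proof. If a hexagon of `Q` is within `ρ` of a corner, the walk `Q` itself is the arm (its far end
is near the opposite arc). Otherwise, by the bond dictionary (`openGraph_reachable_of_clYellowGraph_walk`
applied to the configuration restricted to the bonds of the triangles of `Q`) an active site of the
first hexagon is joined to an active site of the last one by an open path `W` all of whose bonds
are bonds of the up-triangles packaged into the hexagons of `Q`; at mesh `δ/√3` the vertices of the
bond lattice sit at `δ triEmbed y - δ(1+ζ)/3`, within `δ` of the centres `δ triEmbed x` of their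
hexagons, and every bond of `W` lies in the closed `δ`-ball about the centre of its hexagon. The
frontier points of `Ω` in such a ball lie on `A₀ ∪ A₂` (`frontier_near_far_hexagon`: for a hexagon
centre in `Ω` by `far_in`, off `Ω` by `far_out` and the corner modulus of `R`). A run extraction
along `W` (strong induction on the length, `crude_of_walk`): from a vertex on the `A₂`-side (off
`Ω` within `t + δ` of `A₂`, or in `Ω` within `δ` of `A₂`) the walk either stays in `Ω` up to its end
(in `Ω` within `δ` of `A₀`, or off `Ω` near `A₀`) or first leaves `Ω` across `A₀` — a crude crossing
— or across `A₂`, restarting the extraction on a shorter walk; `A₀`-near and `A₂`-near points are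
never within `δ` of each other.

References: B. Bollobás, O. Riordan, *Percolation*, CUP 2006, Ch. 7, Claims 19–20 p. 192, remark
p. 195; L. Chayes, H. K. Lei, Rev. Math. Phys. 19 (2007) §2.1.
-/

noncomputable section

namespace Summit.CriticalPhenomena.CardyFormulaZ2.Theorems.BondTriangularCardyLine

open Set Filter Topology Metric
open Literature.Probability.Percolation Literature.Probability.RandomPlanarGeometry
open Literature.Probability.RandomPlanarGeometry.MarkedDomain
open Literature.Probability.LatticeModels

/-! ### The bond lattice at `embDomainCrossing`-mesh `δ/√3` -/

/-- At mesh `δ/√3` the route's embedding places the bond-lattice vertex `y` at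
`δ (triEmbed y - (1+ζ)/3)`. -/
theorem embScale_mul_zT (δ : ℝ) (y : Site 2) :
    ((δ / Real.sqrt 3 : ℝ) : ℂ) * ((Real.sqrt 3 : ℂ) * (triEmbed y - (1 + triZeta) / 3)) =
      (δ : ℂ) * (triEmbed y - (1 + triZeta) / 3) := by
  have h3 : (Real.sqrt 3 : ℂ) ≠ 0 := by
    exact_mod_cast (Real.sqrt_pos.2 (by norm_num : (0 : ℝ) < 3)).ne'
  push_cast
  field_simp

/-- The bond-lattice vertex `y` of the up-triangle packaged into the hexagon `x` sits within `δ`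
of the hexagon centre `δ triEmbed x`: `δ (triEmbed y - (1+ζ)/3) - δ triEmbed x =
δ triEmbed y - δ hexCenter (x, 0)`. -/
theorem dist_bondVertex_center_le {x y : Site 2} (hy : y ∈ hexFaceVertices (x, 0)) {δ : ℝ} (hδ : 0 < δ) :
    dist ((δ : ℂ) * (triEmbed y - (1 + triZeta) / 3)) (triMeshPoint δ x) ≤ δ := by
  have h := dist_triMeshPoint_hexCenter_le hy δ
  rw [abs_of_pos hδ] at h
  have e : (δ : ℂ) * (triEmbed y - (1 + triZeta) / 3) - triMeshPoint δ x =
      triMeshPoint δ y - (δ : ℂ) * hexCenter (x, 0) := by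
    simp only [triMeshPoint, hexCenter, Fin.val_zero, Nat.cast_zero, zero_add, one_mul]
    ring
  rw [dist_eq_norm, e, ← dist_eq_norm]
  exact h

/-- Adjacent bond-lattice vertices are at distance `δ` at mesh `δ/√3` (the positions are the sites
of `δ𝕋` translated by `-δ(1+ζ)/3`). -/
theorem dist_bondVertex_of_adj {y y' : Site 2} (h : triGraph.Adj y y') {δ : ℝ} (hδ : 0 < δ) :
    dist ((δ : ℂ) * (triEmbed y - (1 + triZeta) / 3)) ((δ : ℂ) * (triEmbed y' - (1 + triZeta) / 3)) = δ := by
  have e : (δ : ℂ) * (triEmbed y - (1 + triZeta) / 3) - (δ : ℂ) * (triEmbed y' - (1 + triZeta) / 3) =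
      triMeshPoint δ y - triMeshPoint δ y' := by simp only [triMeshPoint]; ring
  rw [dist_eq_norm, e, ← dist_eq_norm, dist_triMeshPoint_of_adj h, abs_of_pos hδ]

/-! ### Frontier points near a far hexagon of a longer–thinner domain lie on `A₀ ∪ A₂` -/

/-- **Frontier points within `δ` of the centre of a far hexagon of a longer–thinner domain lie on
`A₀ ∪ A₂`.** If `G` is longer–thinner than `R` at `(t, ρ)`, `x ∈ G` is at distance `≥ ρ` from the
marked points, `η` is a corner modulus of `R` for the radius `ρ/2` and `t + δ < η`, `2δ ≤ ρ`, then a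
frontier point `w` of `Ω` with `dist w (δ x) ≤ δ` is on `A₀ ∪ A₂`: if `δ x ∈ Ω` the arcs `A₁, A₃` are
farther than `δ` (`far_in`); if `δ x ∉ Ω` it is within `t` of `A₀ ∪ A₂` (`far_out`), so `w` on
`A₁ ∪ A₃` would be within `η` of two distinct arcs, hence within `ρ/2` of a corner. -/
theorem frontier_near_far_hexagon (R : ConformalRectangle) {G : TriMarkedDomain 4} {δ t ρ η : ℝ}
    (hG : G.IsLongerThinner R δ t ρ)
    (hη : ∀ q ∈ frontier R.carrier, ∀ i k : Fin 4, k ≠ i → infDist q (R.arc i) < η → infDist q (R.arc k) < η →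
      ∃ m : Fin 4, (m = i ∨ m = i + 1) ∧ R.pt m ∈ R.arc k ∧ dist q (R.pt m) < ρ / 2)
    (htη : t + δ < η) (hδρ : 2 * δ ≤ ρ)
    {x : Site 2} (hx : x ∈ G.verts) (hfar : ∀ j : Fin 4, ρ ≤ dist (triMeshPoint δ x) (R.pt j))
    {w : ℂ} (hw : w ∈ frontier R.carrier) (hwx : dist w (triMeshPoint δ x) ≤ δ) :
    w ∈ R.arc 0 ∨ w ∈ R.arc 2 := by
  rcases frontier_subset_arcs_zero_two R hw with (h | h) | h13
  · exact Or.inl h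
  · exact Or.inr h
  exfalso
  -- the arc `k ∈ {1, 3}` through `w`
  obtain ⟨k, hk13, hwk⟩ : ∃ k : Fin 4, (k = 1 ∨ k = 3) ∧ w ∈ R.arc k := by
    rcases h13 with h | h
    · exact ⟨1, Or.inl rfl, h⟩
    · exact ⟨3, Or.inr rfl, h⟩
  by_cases hxΩ : triMeshPoint δ x ∈ R.carrier
  · -- `far_in`: `δ < infDist (δ x) (A₁ ∪ A₃)`
    have hin := hG.far_in x hx hfar hxΩ
    have hlt : δ < infDist (triMeshPoint δ x) (R.arc k) := by
      rcases hk13 with rfl | rfl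
      · exact hin.1
      · exact hin.2
    have hle : infDist (triMeshPoint δ x) (R.arc k) ≤ dist (triMeshPoint δ x) w := infDist_le_dist_of_mem hwk
    rw [dist_comm] at hle
    linarith
  · -- `far_out`: `δ x` within `t` of `A₀` or `A₂`; corner modulus
    have hout := hG.far_out x hx hfar hxΩ
    obtain ⟨i, hi02, hi⟩ : ∃ i : Fin 4, (i = 0 ∨ i = 2) ∧ infDist (triMeshPoint δ x) (R.arc i) ≤ t := by
      rcases hout with h | h
      · exact ⟨0, Or.inl rfl, h⟩
      · exact ⟨2, Or.inr rfl, h⟩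
    have hki : k ≠ i := by
      rcases hk13 with rfl | rfl <;> rcases hi02 with rfl | rfl <;> decide
    have hwi : infDist w (R.arc i) < η := by
      have := infDist_le_infDist_add_dist (s := R.arc i) (x := w) (y := triMeshPoint δ x)
      linarith
    have hwk' : infDist w (R.arc k) < η := by
      rw [infDist_zero_of_mem hwk]; exact lt_of_le_of_lt infDist_nonneg hwi
    obtain ⟨m, -, -, hm⟩ := hη w hw i k hki hwi hwk'
    have := dist_triangle (triMeshPoint δ x) w (R.pt m)
    rw [dist_comm (triMeshPoint δ x) w] at this
    linarith [hfar m]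

/-- **Leaving `Ω` inside the `δ`-ball of a far hexagon crosses `A₀` or `A₂`**: if `z ∈ Ω` and
`z' ∉ Ω` both lie in the closed `δ`-ball about the centre of a far hexagon of `G` (as in
`frontier_near_far_hexagon`), then some point of `A₀ ∪ A₂` is within `dist z z'` of both. -/
theorem exit_near_far_hexagon (R : ConformalRectangle) {G : TriMarkedDomain 4} {δ t ρ η : ℝ}
    (hG : G.IsLongerThinner R δ t ρ)
    (hη : ∀ q ∈ frontier R.carrier, ∀ i k : Fin 4, k ≠ i → infDist q (R.arc i) < η → infDist q (R.arc k) < η →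
      ∃ m : Fin 4, (m = i ∨ m = i + 1) ∧ R.pt m ∈ R.arc k ∧ dist q (R.pt m) < ρ / 2)
    (htη : t + δ < η) (hδρ : 2 * δ ≤ ρ)
    {x : Site 2} (hx : x ∈ G.verts) (hfar : ∀ j : Fin 4, ρ ≤ dist (triMeshPoint δ x) (R.pt j))
    {z z' : ℂ} (hz : dist z (triMeshPoint δ x) ≤ δ) (hz' : dist z' (triMeshPoint δ x) ≤ δ)
    (hzΩ : z ∈ R.carrier) (hz'Ω : z' ∉ R.carrier) :
    ∃ w, (w ∈ R.arc 0 ∨ w ∈ R.arc 2) ∧ dist z w ≤ dist z z' ∧ dist z' w ≤ dist z z' := by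
  have hns : ¬ segment ℝ z z' ⊆ R.carrier := fun h => hz'Ω (h (right_mem_segment ℝ z z'))
  obtain ⟨w, hwseg, hwfr⟩ := exists_mem_segment_frontier R.isOpen hzΩ hns
  have hwx : dist w (triMeshPoint δ x) ≤ δ := by
    have hball := (convex_closedBall (triMeshPoint δ x) δ).segment_subset (mem_closedBall.2 hz) (mem_closedBall.2 hz') hwseg
    exact mem_closedBall.1 hball
  refine ⟨w, frontier_near_far_hexagon R hG hη htη hδρ hx hfar hwfr hwx, ?_, ?_⟩
  · have := dist_le_dist_of_mem_segment (left_mem_segment ℝ z z') hwseg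
    exact this
  · have := dist_le_dist_of_mem_segment (right_mem_segment ℝ z z') hwseg
    exact this

/-! ### The run extraction along an open bond path whose bonds belong to far hexagons -/

/-- **First exit of a walk from a set of vertices**: a walk starting at a vertex satisfying `P`
either has all its vertices satisfying `P`, or splits as a walk inside `P`, an edge to a vertex
violating `P`, and a strictly shorter remainder. -/
theorem walk_first_exit {V : Type*} (H : SimpleGraph V) (P : V → Prop) :
    ∀ {y₀ v : V} (W₀ : H.Walk y₀ v), P y₀ →
      (∀ z ∈ W₀.support, P z) ∨
        ∃ (y₁ y₂ : V) (W₁ : H.Walk y₀ y₁) (_ : H.Adj y₁ y₂) (W₂ : H.Walk y₂ v),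
          (∀ z ∈ W₁.support, P z) ∧ ¬ P y₂ ∧ W₂.length < W₀.length ∧
          (∀ e ∈ W₁.edges, e ∈ W₀.edges) ∧ (∀ e ∈ W₂.edges, e ∈ W₀.edges) := by
  intro y₀ v W₀
  induction W₀ with
  | nil =>
    intro hy₀
    exact Or.inl fun z hz => by
      rw [SimpleGraph.Walk.support_nil, List.mem_singleton] at hz; rw [hz]; exact hy₀
  | @cons a₀ a₁ _ had W₀' ih₀ =>
    intro hy₀
    by_cases ha₁ : P a₁
    · rcases ih₀ ha₁ with hall | ⟨y₁, y₂, W₁, h12, W₂, hW₁, hy₂, hlt, he₁, he₂⟩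
      · refine Or.inl fun z hz => ?_
        rw [SimpleGraph.Walk.support_cons, List.mem_cons] at hz
        rcases hz with rfl | hz
        · exact hy₀
        · exact hall z hz
      · refine Or.inr ⟨y₁, y₂, SimpleGraph.Walk.cons had W₁, h12, W₂, ?_, hy₂, ?_, ?_, ?_⟩
        · intro z hz
          rw [SimpleGraph.Walk.support_cons, List.mem_cons] at hz
          rcases hz with rfl | hz
          · exact hy₀
          · exact hW₁ z hz
        · simp only [SimpleGraph.Walk.length_cons]; omega
        · intro e he
          rw [SimpleGraph.Walk.edges_cons, List.mem_cons] at he ⊢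
          rcases he with h | h
          · exact Or.inl h
          · exact Or.inr (he₁ e h)
        · intro e he
          rw [SimpleGraph.Walk.edges_cons, List.mem_cons]
          exact Or.inr (he₂ e he)
    · refine Or.inr ⟨a₀, a₁, SimpleGraph.Walk.nil, had, W₀', ?_, ha₁, ?_, ?_, ?_⟩
      · intro z hz
        rw [SimpleGraph.Walk.support_nil, List.mem_singleton] at hz; rw [hz]; exact hy₀
      · simp only [SimpleGraph.Walk.length_cons]; omega
      · intro e he; simp at he
      · intro e he
        rw [SimpleGraph.Walk.edges_cons, List.mem_cons]
        exact Or.inr he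

/-- **Run extraction.** Let `Ω` be the carrier of `R`, `0 < δ`, and let `H` be a graph on the
sites of `𝕋` (the open subgraph of a bond configuration restricted to the bonds of some hexagons)
such that along every edge `y y'` of `H`: `dist (q y) (q y') ≤ δ` for the positions
`q y = δ (triEmbed y - (1+ζ)/3)`, and if `q y ∈ Ω ∌ q y'` then some point of `A₀ ∪ A₂` is within
`δ` of `q y` and of `q y'`; assume moreover that every vertex of `H` off `Ω` met is within `T` of
`A₀` or of `A₂`, and that no two points within `δ` of each other are within `T` of `A₀` and of
`A₂` respectively (`δ ≤ T`). Then every walk of `H` from a vertex on the `A₂`-side (off `Ω` within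
`T` of `A₂`, or in `Ω` within `δ` of `A₂`) to a vertex on the `A₀`-side contains a walk all of whose
vertices are in `Ω`, from a vertex within `δ` of `A₂` to a vertex within `δ` of `A₀`. -/
theorem crude_of_walk :
    ∀ (R : Literature.Probability.RandomPlanarGeometry.ConformalRectangle) (δ T : ℝ), 0 < δ → δ ≤ T →
      ∀ (H : SimpleGraph (Literature.Probability.LatticeModels.Site 2)) (q : Literature.Probability.LatticeModels.Site 2 → ℂ),
      (∀ y y', H.Adj y y' → dist (q y) (q y') ≤ δ) →
      (∀ y y', H.Adj y y' → q y ∈ R.carrier → q y' ∉ R.carrier →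
        ∃ w, (w ∈ R.arc 0 ∨ w ∈ R.arc 2) ∧ dist (q y) w ≤ δ ∧ dist (q y') w ≤ δ) →
      (∀ y y', H.Adj y y' → q y' ∉ R.carrier → Metric.infDist (q y') (R.arc 0) ≤ T ∨ Metric.infDist (q y') (R.arc 2) ≤ T) →
      (∀ z z' : ℂ, dist z z' ≤ δ → Metric.infDist z (R.arc 0) ≤ T → Metric.infDist z' (R.arc 2) ≤ T → False) →
      ∀ (n : ℕ) (y v : Literature.Probability.LatticeModels.Site 2) (W : H.Walk y v), W.length ≤ n →
        ((q y ∉ R.carrier ∧ Metric.infDist (q y) (R.arc 2) ≤ T) ∨ (q y ∈ R.carrier ∧ Metric.infDist (q y) (R.arc 2) ≤ δ)) →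
        ((q v ∉ R.carrier ∧ Metric.infDist (q v) (R.arc 0) ≤ T) ∨ (q v ∈ R.carrier ∧ Metric.infDist (q v) (R.arc 0) ≤ δ)) →
        ∃ (u' v' : Literature.Probability.LatticeModels.Site 2) (W' : H.Walk v' u'),
          Metric.infDist (q u') (R.arc 0) ≤ δ ∧ Metric.infDist (q v') (R.arc 2) ≤ δ ∧
          (∀ z ∈ W'.support, q z ∈ R.carrier) ∧ (∀ e ∈ W'.edges, e ∈ W.edges) := by
  intro R δ T hδ hδT H q hstep hexit hoff hsep n
  induction n with
  | zero =>
    intro y v W hlen hy hv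
    have hnil : W.length = 0 := Nat.le_zero.1 hlen
    have hyv : y = v := SimpleGraph.Walk.eq_of_length_eq_zero hnil
    subst hyv
    rcases hy with ⟨hyΩ, hy2⟩ | ⟨hyΩ, hy2⟩ <;> rcases hv with ⟨hvΩ, hv0⟩ | ⟨hvΩ, hv0⟩
    · exact (hsep (q y) (q y) (by rw [dist_self]; exact hδ.le) hv0 hy2).elim
    · exact (hyΩ hvΩ).elim
    · exact (hvΩ hyΩ).elim
    · exact ⟨y, y, SimpleGraph.Walk.nil, hv0, hy2, fun z hz => by
        rw [SimpleGraph.Walk.support_nil, List.mem_singleton] at hz; rw [hz]; exact hyΩ,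
        fun e he => by simp at he⟩
  | succ n ih =>
    intro y v W hlen hy hv
    -- walks of length `≤ n` are handled by the induction hypothesis
    by_cases hshort : W.length ≤ n
    · exact ih y v W hshort hy hv
    cases W with
    | nil => exact absurd (Nat.zero_le n) (by simp at hshort)
    | @cons _ y' _ hadj W' =>
      have hlen' : W'.length ≤ n := by
        simp only [SimpleGraph.Walk.length_cons] at hlen; omega
      -- the conclusion for `W'` transfers to `cons hadj W'`
      have lift : (∃ (u' v' : Site 2) (W'' : H.Walk v' u'), infDist (q u') (R.arc 0) ≤ δ ∧ infDist (q v') (R.arc 2) ≤ δ ∧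
          (∀ z ∈ W''.support, q z ∈ R.carrier) ∧ (∀ e ∈ W''.edges, e ∈ W'.edges)) →
          ∃ (u' v' : Site 2) (W'' : H.Walk v' u'), infDist (q u') (R.arc 0) ≤ δ ∧ infDist (q v') (R.arc 2) ≤ δ ∧
            (∀ z ∈ W''.support, q z ∈ R.carrier) ∧ (∀ e ∈ W''.edges, e ∈ (SimpleGraph.Walk.cons hadj W').edges) := by
        rintro ⟨u', v', W'', h1, h2, h3, h4⟩
        exact ⟨u', v', W'', h1, h2, h3, fun e he => by
          rw [SimpleGraph.Walk.edges_cons]; exact List.mem_cons_of_mem _ (h4 e he)⟩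
      rcases hy with ⟨hyΩ, hy2⟩ | ⟨hyΩ, hy2⟩
      · -- `y` off `Ω`, near `A₂`
        by_cases hy'Ω : q y' ∈ R.carrier
        · -- entering `Ω` across `A₂`
          obtain ⟨w, hw, hd1, hd2⟩ := hexit y' y hadj.symm hy'Ω hyΩ
          have hw2 : w ∈ R.arc 2 := by
            rcases hw with hw | hw
            · exact (hsep (q y) (q y) (by rw [dist_self]; exact hδ.le)
                (((infDist_le_dist_of_mem hw).trans hd2).trans hδT) hy2).elim
            · exact hw
          exact lift (ih y' v W' hlen' (Or.inr ⟨hy'Ω, (infDist_le_dist_of_mem hw2).trans hd1⟩) hv)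
        · -- staying off `Ω`: `y'` is near `A₂` (near `A₀` is excluded by the separation)
          have hnear : infDist (q y') (R.arc 2) ≤ T := by
            rcases hoff y y' hadj hy'Ω with h0 | h2
            · exact (hsep (q y') (q y) (by rw [dist_comm]; exact hstep y y' hadj) h0 hy2).elim
            · exact h2
          exact lift (ih y' v W' hlen' (Or.inl ⟨hy'Ω, hnear⟩) hv)
      · -- `y` in `Ω`, within `δ` of `A₂`: scan for the first exit
        rcases walk_first_exit H (fun z => q z ∈ R.carrier) (SimpleGraph.Walk.cons hadj W') hyΩ with hall | ⟨y₁, y₂, W₁, h12, W₂, hW₁, hy₂, hlt, he₁, he₂⟩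
        · -- the whole walk stays in `Ω`: its end is within `δ` of `A₀`
          rcases hv with ⟨hvΩ, -⟩ | ⟨-, hv0⟩
          · exact (hvΩ (hall v (SimpleGraph.Walk.end_mem_support _))).elim
          · exact ⟨v, y, (SimpleGraph.Walk.cons hadj W'), hv0, hy2, hall, fun e he => he⟩
        · -- first exit at `y₁ → y₂`
          obtain ⟨w, hw, hd1, hd2⟩ := hexit y₁ y₂ h12 (hW₁ y₁ (SimpleGraph.Walk.end_mem_support _)) hy₂
          rcases hw with hw0 | hw2
          · -- across `A₀`: the run `W₁` is the crude crossing
            exact ⟨y₁, y, W₁, (infDist_le_dist_of_mem hw0).trans hd1, hy2, hW₁, he₁⟩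
          · -- across `A₂`: restart from `y₂`, on a shorter walk
            have hlen₂ : W₂.length ≤ n := by
              simp only [SimpleGraph.Walk.length_cons] at hlt hlen; omega
            obtain ⟨u', v', W'', h1, h2, h3, h4⟩ :=
              ih y₂ v W₂ hlen₂ (Or.inl ⟨hy₂, (infDist_le_dist_of_mem hw2).trans (hd2.trans hδT)⟩) hv
            exact ⟨u', v', W'', h1, h2, h3, fun e he => he₂ e (h4 e he)⟩

/-! ### The slack of the crude event -/

/-- `√3 ≤ 2`, so the gate slack `δ` is within the slack `2δ/√3` of the crude event. -/
theorem le_two_mul_div_sqrt_three {δ : ℝ} (hδ : 0 ≤ δ) : δ ≤ 2 * (δ / Real.sqrt 3) := by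
  have h3 : 0 < Real.sqrt 3 := Real.sqrt_pos.2 (by norm_num)
  have hle : Real.sqrt 3 ≤ 2 := by
    rw [show (2 : ℝ) = Real.sqrt 4 by rw [show (4 : ℝ) = 2 ^ 2 by norm_num, Real.sqrt_sq (by norm_num)]]
    exact Real.sqrt_le_sqrt (by norm_num)
  rw [mul_div_assoc', le_div_iff₀ h3]
  nlinarith

end Summit.CriticalPhenomena.CardyFormulaZ2.Theorems.BondTriangularCardyLine

end
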